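import Summits.BirchSwinnertonDyer.BirchSwinnertonDyer.Theorems.ManinLocalTwoThreeKummerValuesHalfIndex
import Summits.BirchSwinnertonDyer.BirchSwinnertonDyer.Theorems.ManinLocalTwoThreeFlatGamma1Datum
import Literature.NumberTheory.EllipticCurves.VariableChangePointsMap
import Literature.NumberTheory.EllipticCurves.RealLatticePeriod
import Literature.NumberTheory.EllipticCurves.LFunctionSmulProofs
import HarnessLib

/-!
# THEOREM K in the index-`4` world from T-es-75 ALONE, for EVERY `c₀`: the doubled model carries an optimal `X₁(N)`-datum
(route `ManinLocalTwoThree`, crux C2 `ManinOddAtFour` stmt-BirchSwinnertonDyer-22967; cell bsd-f2-manin, prover seat p3 gen 20;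
`--supports stmt-BirchSwinnertonDyer-22967`; sequel of `…KummerValuesHalfIndex`)

So far the Kummer values of THEOREM K came either from Stevens' curve (CES ∧ T-es-75, es `indexFour_kummerDiamondReciprocity`, any `c₀`)
or, for EVEN `c₀`, from T-es-75 alone on p2's flat `X₁(N)`-datum of `W₀` (`c = c₀/2`).  For ODD `c₀` there is no `X₁(N)`-datum on the
MODEL `W₀` with the half point `π₀(c₀ s/2)` as its value — but there is one on the DOUBLED MODEL `W₀'' = C • W₀`, `C = (2; 0, 0, 0)`
(`x'' = x/4`, `y'' = y/8`), whose Néron-type lattice is `2Λ_{W₀}`: with uniformisation `π''(z) = ι(π₀(z/2))` (`ι : W₀(ℂ) ≃ W₀''(ℂ)` the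
substitution, a Galois-equivariant group isomorphism, tree `VariableChange.pointEquivBaseChange`) and `c'' = c₀`, the inclusion
`c₀Λ₁(f) ⊆ 2Λ_{W₀} = 2c₀Λ₀(f)` is the half-index hypothesis, and OPTIMALITY `2Λ_{W₀} = c₀Λ₁(f)` is the index-`4` hypothesis.  T-es-75 is
typed for every elliptic `W` (no minimality, no integrality), so THEOREM K♮ (es `kummerDiamondReciprocity`) applies to `W₀''` and transports
back along `ι`:  **THEOREM K's Kummer values on `W₀` in the index-`4` world ⟸ T-es-75, for every `c₀`, with NO CES and NO CDT.**

* §1 `exists_gamma1ParametrizationData_smul` — transport of an `X₀(N)`-datum of `W₀` to an `X₁(N)`-datum of `C • W₀` for ANY change of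
  variables `C = (u; r, s, t)` over `ℚ` and any integer multiplier `c` with `cΛ₁(f) ⊆ uΛ_{W₀}` (lattice `uΛ_{W₀}`, uniformisation
  `z ↦ ι(π₀(u⁻¹z))`; the `℘`-normalisation is Silverman III.1 Table 3.1, adapted from the ABC cell's `nonempty_modularParametrizationData_of_smul`;
  the degree is p2's `FlatGamma1Datum.exists_gamma1_modularDegree`).
* §2 `indexFour_kummerValues_of_Tes75` — THEOREM K's conclusion ⟸ T-es-75 (index `4`, any `c₀`); whence BY NAME with ONE printed fact fewer:
  `indexFourForcesFreyTwistShape_of_Tes75 : T-es-75 → E-es-185`, `indexFourForcesFullRationalTwoTorsion_of_Tes75 : T-es-75 → E-an-152d`,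
  `shimuraIndexNeFourAtFour_of_modularity_Tes75 : exists_isNewformOf → T-es-75 → E-an-152b` (and the T-es-75♭ twins).

HONEST FRAMING: CONDITIONAL on the statement-only printed fact T-es-75 (Stevens 1982 Thm 1.3.1 (b) along `X₁(N)`-data); C2 `ManinOddAtFour`
(⟸ CDT ∧ T-es-75, p2's closer of record), Manin's conjecture and BSD are NOT proved here.  No definitions, no sorry.
[cite: Stevens1982, §1.3 Thm. 1.3.1 (b)] [cite: SilvermanAEC2009, III.1 Table 3.1] [cite: Stevens1989, §2]
-/

set_option autoImplicit false
-- lint-debt: the directory name repeats the summit name (sibling precedent `ManinLocalTwoThreeKummerValuesHalfIndex.lean`)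
set_option linter.dupNamespace false

noncomputable section

open scoped Classical MatrixGroups PeriodPair
open Complex CongruenceSubgroup WeierstrassCurve WeierstrassCurve.Affine WeierstrassCurve.Affine.Point
open UpperHalfPlane hiding I
open Literature.NumberTheory.EllipticCurves Literature.NumberTheory.EllipticCurves.ModularForms
open Literature.NumberTheory.EllipticCurves.Greenberg1999 Literature.NumberTheory.Automorphic
open Summit.BirchSwinnertonDyer.Rank1Residual.ManinAdditive.KummerDiamond

namespace Summit.BirchSwinnertonDyer.BirchSwinnertonDyer.Theorems.ManinLocalTwoThree.KummerValues

/-! ## §1 An `X₀(N)`-datum of `W₀` yields an `X₁(N)`-datum on every model `C • W₀` -/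

section Transport

variable {W₀ : WeierstrassCurve ℚ} [W₀.IsElliptic] {N : ℕ} [NeZero N]

/-- Two affine points with equal coordinates are equal (proof-irrelevance plumbing, as in `…DatumModelChange`). [folklore] -/
private theorem point_some_eq_some {F : Type*} [Field F] {V : WeierstrassCurve F} {x y x' y' : F}
    (h : V.toAffine.Nonsingular x y) (h' : V.toAffine.Nonsingular x' y') (hx : x = x') (hy : y = y') :
    (Affine.Point.some x y h : V.toAffine.Point) = Affine.Point.some x' y' h' := by
  subst hx hy; rfl

/-- **Transport of an `X₀(N)`-datum of `W₀` to an `X₁(N)`-datum of the model `C • W₀`.**  For a change of variables `C = (u; r, s, t)` over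
`ℚ` the Néron-type lattice of `C • W₀` is `uΛ_{W₀}` (`ω_{C•W} = u⁻¹·ω_W` up to the substitution; Silverman III.1 Table 3.1), its
uniformisation is `z ↦ ι(π₀(u⁻¹z))` with `ι : W₀(ℂ) ≃+ (C • W₀)(ℂ)` the substitution on points, and for every integer `c ≠ 0` with
`cΛ₁(f) ⊆ uΛ_{W₀}` this is an `X₁(N)`-datum with Manin constant `c` (degree by p2's `exists_gamma1_modularDegree`).  Existence only, no
definition. [cite: SilvermanAEC2009, III.1 Table 3.1] [cite: CesnaviciusNeururerSaha2023, §1] -/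
theorem exists_gamma1ParametrizationData_smul (D₀ : ModularParametrizationData W₀ N) (C : VariableChange ℚ) {c : ℤ} (hc0 : c ≠ 0)
    (hc : ∀ z ∈ periodLatticeGamma1 D₀.f,
      (c : ℂ) * z ∈ (D₀.L.mulLeft ((C.u : ℚ) : ℂ) (by exact_mod_cast C.u.ne_zero)).lattice) :
    ∃ D₁ : Gamma1ParametrizationData (C • W₀) N, D₁.f = D₀.f ∧ D₁.c = c ∧
      D₁.L = D₀.L.mulLeft ((C.u : ℚ) : ℂ) (by exact_mod_cast C.u.ne_zero) ∧
      ∀ z : ℂ, D₁.uniformize z = VariableChange.pointEquivBaseChange W₀ C ℂ (D₀.uniformize ((((C.u : ℚ) : ℂ))⁻¹ * z)) := by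
  -- adapted from the ABC cell's `nonempty_modularParametrizationData_of_smul` (`Summits/ABC/ABC/Theorems/DefiniteXiFreyModularity.lean`),
  -- in the opposite direction (`W₀ ↦ C • W₀`) and with the `Γ₁(N)`-degree of p2's `FlatGamma1Datum.exists_gamma1_modularDegree`
  set u : ℚ := (C.u : ℚ) with hu_def
  have hu : u ≠ 0 := C.u.ne_zero
  have huC : (u : ℂ) ≠ 0 := by exact_mod_cast hu
  have huCi : (u : ℂ)⁻¹ ≠ 0 := inv_ne_zero huC
  set Cc : VariableChange ℂ := C.map (algebraMap ℚ ℂ) with hCc_def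
  have hCcu : ((Cc.u : ℂˣ) : ℂ) = (u : ℂ) := by
    simp [hCc_def, VariableChange.map_u, hu_def]
  have hCcui : ((Cc.u⁻¹ : ℂˣ) : ℂ) = (u : ℂ)⁻¹ := by
    rw [Units.val_inv_eq_inv_val, hCcu]
  have hCcr : Cc.r = (C.r : ℂ) := by simp [hCc_def]
  have hCcs : Cc.s = (C.s : ℂ) := by simp [hCc_def]
  have hCct : Cc.t = (C.t : ℂ) := by simp [hCc_def]
  have hsmul : (C • W₀).baseChange ℂ = Cc • W₀.baseChange ℂ := VariableChange.baseChange_smul_eq W₀ C ℂ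
  set ι : (W₀.baseChange ℂ).toAffine.Point ≃+ ((C • W₀).baseChange ℂ).toAffine.Point :=
    VariableChange.pointEquivBaseChange W₀ C ℂ with hι_def
  -- the lattice `u Λ_{W₀}`
  set L : PeriodPair := D₀.L.mulLeft (u : ℂ) huC with hL_def
  have hmemL : ∀ z : ℂ, z ∈ L.lattice ↔ (u : ℂ)⁻¹ * z ∈ D₀.L.lattice := fun z ↦ by
    rw [hL_def, PeriodPair.mem_mulLeft_lattice]
  -- the uniformisation `z ↦ ι (π₀ (u⁻¹ z))`
  set ψ : ℂ →+ ((C • W₀).baseChange ℂ).toAffine.Point :=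
    ι.toAddMonoidHom.comp (D₀.uniformize.comp (AddMonoidHom.mulLeft (u : ℂ)⁻¹)) with hψ_def
  have hψ : ∀ z, ψ z = ι (D₀.uniformize ((u : ℂ)⁻¹ * z)) := fun z ↦ rfl
  have hker : (ψ.ker : Set ℂ) = L.lattice := by
    ext z
    rw [SetLike.mem_coe, AddMonoidHom.mem_ker, hψ, AddEquiv.map_eq_zero_iff, D₀.uniformize_eq_zero_iff, SetLike.mem_coe, hmemL]
  have hsurj : Function.Surjective ψ := by
    intro P
    obtain ⟨w, hw⟩ := D₀.uniformize_surjective (ι.symm P)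
    refine ⟨(u : ℂ) * w, ?_⟩
    rw [hψ, ← mul_assoc, inv_mul_cancel₀ huC, one_mul, hw, AddEquiv.apply_symm_apply]
  -- the degree of `τ ↦ [c · 2πi∫f] ∈ ℂ/L`, transported to `(C • W₀)(ℂ)`
  have hf : D₀.f ≠ 0 := D₀.isNewformOf.1.ne_zero
  have hc0' : (c : ℂ) ≠ 0 := by exact_mod_cast hc0
  obtain ⟨d, hd, hfin⟩ := FlatGamma1Datum.exists_gamma1_modularDegree hf hc0' hc
  have hker' : L.lattice.toAddSubgroup = ψ.ker := SetLike.coe_injective (by rw [Submodule.coe_toAddSubgroup, hker])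
  let e : ℂ ⧸ L.lattice.toAddSubgroup ≃+ ((C • W₀).baseChange ℂ).toAffine.Point :=
    QuotientAddGroup.liftEquiv L.lattice.toAddSubgroup hsurj hker'
  have he : ∀ x : ℂ, e.toEquiv (x : ℂ ⧸ L.lattice.toAddSubgroup) = ψ x := fun _ ↦ rfl
  have key := (FlatGamma1Datum.finite_setOf_natCard_gamma1FiberOrbits_ne_iff e.toEquiv
    (fun τ : ℍ ↦ (((c : ℂ) * eichlerIntegral D₀.f τ : ℂ) : ℂ ⧸ L.lattice.toAddSubgroup)) d).mpr hfin
  simp only [he] at key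
  refine ⟨{
    f := D₀.f
    isNewformOf := ⟨D₀.isNewformOf.1, fun n ↦ by rw [D₀.isNewformOf.2 n, WeierstrassCurve.LFunction_smul]⟩
    L := L
    isNeronLattice := ?_
    uniformize := ψ
    ker_uniformize := hker
    uniformize_surjective := hsurj
    uniformize_spec := ?_
    c := c
    smul_periodLatticeGamma1_le := hc
    deg := d
    deg_pos := hd
    deg_spec := key }, rfl, rfl, rfl, fun z ↦ rfl⟩
  · -- `g₂(uΛ) = u⁻⁴ g₂(Λ) = c₄(C • W₀)/12`, `g₃(uΛ) = u⁻⁶ g₃(Λ) = c₆(C • W₀)/216`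
    obtain ⟨h₂, h₃⟩ := D₀.isNeronLattice
    constructor
    · rw [hL_def, PeriodPair.g₂_mulLeft, h₂, WeierstrassCurve.baseChange, WeierstrassCurve.map_c₄, WeierstrassCurve.baseChange,
        WeierstrassCurve.map_c₄, WeierstrassCurve.variableChange_c₄]
      simp only [map_mul, map_pow, Units.val_inv_eq_inv_val, map_inv₀, eq_ratCast, inv_pow]
      rw [← hu_def]
      field_simp
    · rw [hL_def, PeriodPair.g₃_mulLeft, h₃, WeierstrassCurve.baseChange, WeierstrassCurve.map_c₆, WeierstrassCurve.baseChange,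
        WeierstrassCurve.map_c₆, WeierstrassCurve.variableChange_c₆]
      simp only [map_mul, map_pow, Units.val_inv_eq_inv_val, map_inv₀, eq_ratCast, inv_pow]
      rw [← hu_def]
      field_simp
  · -- the `℘`-normalisation on `C • W₀`
    intro z hz
    have hz' : (u : ℂ)⁻¹ * z ∉ D₀.L.lattice := fun h ↦ hz ((hmemL z).mpr h)
    obtain ⟨h', hspec⟩ := D₀.uniformize_spec ((u : ℂ)⁻¹ * z) hz'
    -- homogeneity of `℘`, `℘'`
    have hP : ℘[L] z = ((u : ℂ) ^ 2)⁻¹ * ℘[D₀.L] ((u : ℂ)⁻¹ * z) := by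
      have h := PeriodPair.weierstrassP_mulLeft (u : ℂ) huC D₀.L ((u : ℂ)⁻¹ * z)
      rw [← mul_assoc, mul_inv_cancel₀ huC, one_mul] at h
      rw [hL_def, h]
    have hP' : ℘'[L] z = ((u : ℂ) ^ 3)⁻¹ * ℘'[D₀.L] ((u : ℂ)⁻¹ * z) := by
      have h := PeriodPair.derivWeierstrassP_mulLeft (u : ℂ) huC D₀.L ((u : ℂ)⁻¹ * z)
      rw [← mul_assoc, mul_inv_cancel₀ huC, one_mul] at h
      rw [hL_def, h]
    -- the coefficients of `C • W₀` over `ℂ`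
    have hb₂ : ((C • W₀).baseChange ℂ).b₂ = (u : ℂ)⁻¹ ^ 2 * ((W₀.baseChange ℂ).b₂ + 12 * (C.r : ℂ)) := by
      rw [hsmul, WeierstrassCurve.variableChange_b₂, hCcui, hCcr]
    have ha₁ : ((C • W₀).baseChange ℂ).a₁ = (u : ℂ)⁻¹ * ((W₀.baseChange ℂ).a₁ + 2 * (C.s : ℂ)) := by
      rw [hsmul, WeierstrassCurve.variableChange_a₁, hCcui, hCcs]
    have ha₃ : ((C • W₀).baseChange ℂ).a₃ = (u : ℂ)⁻¹ ^ 3 *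
        ((W₀.baseChange ℂ).a₃ + (C.r : ℂ) * (W₀.baseChange ℂ).a₁ + 2 * (C.t : ℂ)) := by
      rw [hsmul, WeierstrassCurve.variableChange_a₃, hCcui, hCcr, hCct]
    -- the coordinates of `π₀(u⁻¹ z)` and their images under the substitution
    set X : ℂ := ℘[D₀.L] ((u : ℂ)⁻¹ * z) - (W₀.baseChange ℂ).b₂ / 12 with hX
    set Y : ℂ := (℘'[D₀.L] ((u : ℂ)⁻¹ * z) - (W₀.baseChange ℂ).a₁ * (℘[D₀.L] ((u : ℂ)⁻¹ * z) - (W₀.baseChange ℂ).b₂ / 12) -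
      (W₀.baseChange ℂ).a₃) / 2 with hY
    have hx : Cc.toX X = ℘[L] z - ((C • W₀).baseChange ℂ).b₂ / 12 := by
      rw [VariableChange.toX_def, hCcui, hCcr, hX, hP, hb₂]
      field_simp
      ring
    have hy : Cc.toY X Y = (℘'[L] z - ((C • W₀).baseChange ℂ).a₁ * (℘[L] z - ((C • W₀).baseChange ℂ).b₂ / 12) -
        ((C • W₀).baseChange ℂ).a₃) / 2 := by
      rw [VariableChange.toY_def, hCcui, hCcr, hCcs, hCct, hX, hY, hP, hP', hb₂, ha₁, ha₃]
      field_simp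
      ring
    have h₁ : ((C • W₀).baseChange ℂ).toAffine.Nonsingular (℘[L] z - ((C • W₀).baseChange ℂ).b₂ / 12)
        ((℘'[L] z - ((C • W₀).baseChange ℂ).a₁ * (℘[L] z - ((C • W₀).baseChange ℂ).b₂ / 12) - ((C • W₀).baseChange ℂ).a₃) / 2) := by
      have h := (VariableChange.nonsingular_iff (W₀.baseChange ℂ) Cc X Y).mpr h'
      rw [hx, hy, ← hsmul] at h
      exact h
    refine ⟨h₁, ?_⟩
    rw [hψ, hspec, hι_def, VariableChange.pointEquivBaseChange_some]
    exact point_some_eq_some _ _ hx hy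

end Transport

/-! ## §2 THEOREM K's Kummer values in the index-`4` world from T-es-75 alone (any `c₀`); the by-name rows with CES removed -/

section IndexFour

variable (W₀ : WeierstrassCurve ℚ) [W₀.IsElliptic] {N : ℕ} [NeZero N] (D₀ : ModularParametrizationData W₀ N)

/-- **THEOREM K ⟸ T-es-75, index `4`, ANY `c₀` (no CES, no CDT).**  On the doubled model `C • W₀`, `C = (2; 0, 0, 0)`, the datum of §1 with
`c = c₀` has lattice `2Λ_{W₀} ⊇ c₀Λ₁(f)` (⟸ `Λ₁ ⊆ 2Λ₀`) and is OPTIMAL by the lattice clause `Λ_{W₀} = c₀Λ₀(f)` and `Λ₁(f) = 2Λ₀(f)`;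
THEOREM K♮ (es `kummerDiamondReciprocity`, ⟸ T-es-75) on it reads, after the Galois-equivariant substitution `ι`
(`VariableChange.pointEquivBaseChange_map_algEquiv`), as the Kummer values of the halves `S_y = π₀(c₀{∞,1/y}_f/2)` on `W₀`.  CONDITIONAL on T-es-75.
[cite: Stevens1982, §1.3 Thm. 1.3.1 (b)] [cite: SilvermanAEC2009, III.1 Table 3.1] [cite: Stevens1989, §2] -/
theorem indexFour_kummerValues_of_Tes75 (hSt : optimalGamma1Parametrization_cuspInv_galoisAction)
    (hopt : ∀ z ∈ D₀.L.lattice, ∃ w ∈ periodLattice D₀.f, z = D₀.c * w)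
    (h4 : ∀ z : ℂ, z ∈ periodLatticeGamma1 D₀.f ↔ ∃ w ∈ periodLattice D₀.f, z = 2 * w)
    (σ : ℂ ≃ₐ[ℚ] ℂ) (d d' : ℤ) (hdd' : ((d * d' : ℤ) : ZMod N) = 1)
    (hσ : σ (Complex.exp (2 * Real.pi * Complex.I / N)) = Complex.exp (2 * Real.pi * Complex.I * d / N))
    (Q y : ℕ) (hQy : Q * y = N) (hcop : Nat.Coprime Q y) (γ : Gamma0 N)
    (hγQ : (((γ : SL(2, ℤ)) 1 1 : ℤ) : ZMod Q) = (d' : ZMod Q)) (hγy : (((γ : SL(2, ℤ)) 1 1 : ℤ) : ZMod y) = 1) :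
    Affine.Point.map (W' := W₀) (σ : ℂ →ₐ[ℚ] ℂ) (D₀.uniformize ((D₀.c : ℂ) * modularSymbol D₀.f (1 / (y : ℚ)) / 2)) =
      D₀.uniformize ((D₀.c : ℂ) * modularSymbol D₀.f (1 / (y : ℚ)) / 2) +
        D₀.uniformize ((D₀.c : ℂ) * cuspSymbol D₀.f γ / 2) := by
  -- the doubling change of variables `C = (2; 0, 0, 0)`
  set C : VariableChange ℚ := ⟨Units.mk0 2 two_ne_zero, 0, 0, 0⟩ with hC
  have hCu : ((C.u : ℚ) : ℂ) = 2 := by rw [hC]; push_cast [Units.val_mk0]; norm_num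
  have hc₀ : D₀.c ≠ 0 := D₀.maninConstant_ne_zero_holds
  -- `c₀ Λ₁(f) ⊆ 2 Λ_{W₀}`
  have hc : ∀ z ∈ periodLatticeGamma1 D₀.f,
      (D₀.c : ℂ) * z ∈ (D₀.L.mulLeft ((C.u : ℚ) : ℂ) (by exact_mod_cast C.u.ne_zero)).lattice := by
    intro z hz
    obtain ⟨w, hw, rfl⟩ := (h4 z).mp hz
    rw [PeriodPair.mem_mulLeft_lattice, hCu, show (2 : ℂ)⁻¹ * ((D₀.c : ℂ) * (2 * w)) = (D₀.c : ℂ) * w by ring]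
    exact D₀.smul_periodLattice_le w hw
  obtain ⟨D₁, hf, hc₁, hL, hu⟩ := exists_gamma1ParametrizationData_smul D₀ C hc₀ hc
  -- optimality `2Λ_{W₀} = c₀Λ₁(f)`
  have hopt₁ : D₁.IsOptimal := by
    intro z hz
    rw [hL, PeriodPair.mem_mulLeft_lattice, hCu] at hz
    obtain ⟨w, hw, hzw⟩ := hopt _ hz
    refine ⟨2 * w, ?_, ?_⟩
    · rw [hf]; exact (h4 _).mpr ⟨w, hw, rfl⟩
    · rw [hc₁]
      have e : z = 2 * ((2 : ℂ)⁻¹ * z) := by ring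
      rw [e, hzw]; ring
  -- THEOREM K♮ on the doubled model, transported along `ι`
  have hK := kummerDiamondReciprocity hSt (C • W₀) D₁ hopt₁ σ d d' hdd' hσ Q y hQy hcop γ hγQ hγy
  simp only [hf, hc₁, hu, hCu] at hK
  rw [← map_add, ← VariableChange.pointEquivBaseChange_map_algEquiv,
    (VariableChange.pointEquivBaseChange W₀ C ℂ).apply_eq_iff_eq] at hK
  have e1 : (2 : ℂ)⁻¹ * ((D₀.c : ℂ) * modularSymbol D₀.f (1 / (y : ℚ))) = (D₀.c : ℂ) * modularSymbol D₀.f (1 / (y : ℚ)) / 2 := by ring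
  have e2 : (2 : ℂ)⁻¹ * ((D₀.c : ℂ) * cuspSymbol D₀.f γ) = (D₀.c : ℂ) * cuspSymbol D₀.f γ / 2 := by ring
  rw [e1, e2] at hK
  exact hK

/-- **E-es-185♭ per datum in the index-`4` world ⟸ T-es-75 alone, ANY `c₀`** (Kummer values from the doubled model into
`two_pow_five_dvd_and_hasFreyTwistShape_of_kummerValues'`).  CONDITIONAL on T-es-75. [cite: Stevens1982, §1.3 Thm. 1.3.1 (b)] [cite: Stevens1989, §2] -/
theorem two_pow_five_dvd_and_hasFreyTwistShape_of_indexFour_of_Tes75 (hSt : optimalGamma1Parametrization_cuspInv_galoisAction)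
    (hopt : ∀ z ∈ D₀.L.lattice, ∃ w ∈ periodLattice D₀.f, z = D₀.c * w)
    (h4 : ∀ z : ℂ, z ∈ periodLatticeGamma1 D₀.f ↔ ∃ w ∈ periodLattice D₀.f, z = 2 * w) :
    2 ^ 5 ∣ N ∧ HasFreyTwistShape W₀ :=
  two_pow_five_dvd_and_hasFreyTwistShape_of_kummerValues' W₀ D₀ hopt h4 (indexFour_kummerValues_of_Tes75 W₀ D₀ hSt hopt h4)

end IndexFour

/-! ### The by-name rows with CES removed -/

/-- **E-es-185 `KummerDiamond.IndexFourForcesFreyTwistShape` BY NAME ⟸ T-es-75 ALONE** (LEAD: ⟸ F★ ∧ CES ∧ T-es-75; this seat's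
`…RationalTwoTorsion`: ⟸ CES ∧ T-es-75; now CES is gone too).  CONDITIONAL on ONE statement-only printed fact (Stevens 1982 Thm 1.3.1 (b));
nothing about BSD. [cite: Stevens1982, §1.3 Thm. 1.3.1 (b)] [cite: Stevens1989, §2] -/
theorem indexFourForcesFreyTwistShape_of_Tes75 (hSt : optimalGamma1Parametrization_cuspInv_galoisAction) : IndexFourForcesFreyTwistShape :=
  fun W₀ _ _ _ _ D₀ hopt h4 ↦ two_pow_five_dvd_and_hasFreyTwistShape_of_indexFour_of_Tes75 W₀ D₀ hSt hopt h4

/-- **E-an-152d `CDivisionNeron.IndexFourForcesFullRationalTwoTorsion` BY NAME ⟸ T-es-75 ALONE.** CONDITIONAL. [cite: Stevens1982, §1.3 Thm. 1.3.1 (b)] -/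
theorem indexFourForcesFullRationalTwoTorsion_of_Tes75 (hSt : optimalGamma1Parametrization_cuspInv_galoisAction) :
    CDivisionNeron.IndexFourForcesFullRationalTwoTorsion :=
  fun W₀ _ _ _ _ D₀ hopt _ h4 ↦
    exists_three_hasRationalTwoTorsionX_of_kummerValues D₀ hopt (indexFour_kummerValues_of_Tes75 W₀ D₀ hSt hopt h4)

/-- **E-an-152b `ShimuraKernel.ShimuraIndexNeFourAtFour` BY NAME ⟸ modularity ∧ T-es-75** (index-`4` exclusion for lattice-optimal data with
`4 ∣ N`; E-es-186♭ = Tate's family C).  CONDITIONAL on two statement-only printed facts. [cite: Stevens1982, §1.3 Thm. 1.3.1 (b)] -/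
theorem shimuraIndexNeFourAtFour_of_modularity_Tes75 (hnf : exists_isNewformOf) (hSt : optimalGamma1Parametrization_cuspInv_galoisAction) :
    Summit.BirchSwinnertonDyer.Rank1Residual.ManinAdditive.ShimuraKernel.ShimuraIndexNeFourAtFour :=
  FreyTwistConductor.shimuraIndexNeFourAtFour_of_modularity_shape185 hnf (indexFourForcesFreyTwistShape_of_Tes75 hSt)

/-- **E-es-185 BY NAME ⟸ T-es-75♭** (cyclotomic currency). CONDITIONAL. [cite: Stevens1982, §1.3 Thm. 1.3.1 (a), (b)] -/
theorem indexFourForcesFreyTwistShape_of_Tes75flat (hSt : optimalGamma1Parametrization_cuspInv_cyclotomic_galois) :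
    IndexFourForcesFreyTwistShape :=
  indexFourForcesFreyTwistShape_of_Tes75 (optimalGamma1Parametrization_cuspInv_galoisAction_of_cyclotomic hSt)


end Summit.BirchSwinnertonDyer.BirchSwinnertonDyer.Theorems.ManinLocalTwoThree.KummerValues

end
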